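import Literature.Combinatorics.SimpleGraph.TutteFragment
import Mathlib.Data.Fintype.Basic
import Mathlib.Data.Fintype.Sum
import Mathlib.Data.Fintype.Prod
import Mathlib.Tactic.DeriveFintype
import HarnessLib

/-!
# The XOR-gadget of Garey–Johnson–Tarjan / Liśkiewicz–Ogihara–Toda, with its contraction stages

The XOR-gadget of the reduction `#3SAT ≤ᵖ_{r-shift} #HamPath-Plan3` (Liśkiewicz–Ogihara–Toda,
TCS 304 (2003), §3, Fig. 2 (a), taken "without changes" from Garey–Johnson–Tarjan 1976): "The
XOR-gadget is a ladder built using eight copies of the Tutte-gadget (see Fig. 2a). To go through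
all the nodes in an XOR-gadget one has to enter and exit on the same vertical axis. Moreover for
each of the two vertical axes there are `(4 · 2)⁴ = 2¹²` Hamiltonian paths that traverse the
gadget." Read off Fig. 2 (a) (report version ECCC TR01-061 rev. 2, p. 6): two vertical LINES
(the two coupled edges), each carrying four copies of the Tutte gadget (`TutteFragment.lean`)
in series, the terminals along a line reading `a b | b a | a b | b a` from top to bottom, and
four RUNGS joining the `c`-terminals of the copies facing each other.

This file defines the gadget in the form in which its census is COMPUTED
(`LOTXorGadgetCensus.lean`): the eight Tutte copies are contracted one after the other by the
three-port identity `PortGadget.hamCountRF_eq` (`HamiltonianPortGadgetCount.lean`), so all nine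
stages are laid out in ONE graph `xorGraph` on the vertex type `XV` — the `8 × 15` copy vertices
`tv s l i`, one contracted incarnation `tau s l` per copy (joined to both incarnations of each of
the copy's three outside neighbours), the four line ends `port j` (`0, 1` = top / bottom of the
left line, `2, 3` = of the right line), frame vertices `fr p q` (a host path `p – fr p q – q`
through which the census computations close up a strand outside the gadget) and a joiner `jn`
adjacent to the four line ends — the stage and the outside vertices in use being selected by the
vertex set (`stageVerts n E`: copies of index `< n` expanded, the others contracted, plus the
outside vertices `E`; `IsHamPathOn` only sees adjacency inside the vertex set).

* `XV`, `XV.topT`, `XV.botT` (which terminal of copy `l` is on top: `a` for even `l`, `b` for odd),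
  `topNbrs`, `botNbrs`, `rungNbrs`, `extNbrs`, `xadj`, **`xorGraph`**;
* `xadj_symm`, `xadj_irrefl` (by `decide`), degree sanity checks;
* `cidx`, `inCore`, `stageVerts n E` (outside vertices `E`), `copyList`/`copyVerts`,
  `hostVerts`, `ports`; the gadget proper is `stageVerts 8 ports` (the 120 copy vertices with
  the four line ends).

## References

* M. Liśkiewicz, M. Ogihara, S. Toda, TCS 304 (2003) 129–156, §3, Fig. 2 (a).
* M. R. Garey, D. S. Johnson, R. E. Tarjan, SIAM J. Comput. 5 (1976) 704–714.
-/

namespace Literature.Combinatorics.SimpleGraph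

/-- **Vertices of the staged XOR-gadget**: `tv s l i` = vertex `i` of the Tutte copy at level
`l` of line `s`; `tau s l` = that copy contracted to one vertex; `port j` = the four line ends
(`0` top-left, `1` bottom-left, `2` top-right, `3` bottom-right); `fr p q` = a FRAME vertex
joining the line ends `p` and `q` (a two-edge host path `p – fr p q – q`, present only in the
census computations that route the outside of a strand through it; `fr p q` and `fr q p` are
distinct names for the same role, only `p < q` is used); `jn` = a joiner of the four line ends.
[cite: LiskiewiczOgiharaToda2003, §3, Fig. 2 (a)] -/
inductive XV
  | tv (s : Fin 2) (l : Fin 4) (i : Fin 15)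
  | tau (s : Fin 2) (l : Fin 4)
  | port (j : Fin 4)
  | fr (p q : Fin 4)
  | jn
  deriving DecidableEq, Fintype

namespace XV

/-- The terminal of the copy at level `l` facing UP the line: `a = 0` at even levels, `b = 1` at
odd levels ("a b | b a | a b | b a"). [cite: LiskiewiczOgiharaToda2003, §3, Fig. 2 (a)] -/
def topT (l : Fin 4) : Fin 15 := if l.val % 2 = 0 then 0 else 1

/-- The terminal facing DOWN the line. [cite: LiskiewiczOgiharaToda2003, §3, Fig. 2 (a)] -/
def botT (l : Fin 4) : Fin 15 := if l.val % 2 = 0 then 1 else 0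

/-- The top end of line `s`. [cite: LiskiewiczOgiharaToda2003, §3, Fig. 2 (a)] -/
def topPort (s : Fin 2) : Fin 4 := if s = 0 then 0 else 2

/-- The bottom end of line `s`. [cite: LiskiewiczOgiharaToda2003, §3, Fig. 2 (a)] -/
def botPort (s : Fin 2) : Fin 4 := if s = 0 then 1 else 3

/-- Both incarnations of the neighbour ABOVE the copy `(s, l)` on its line: the bottom terminal of
the copy above and its contracted incarnation, or the top line end.
[cite: LiskiewiczOgiharaToda2003, §3, Fig. 2 (a)] -/
def topNbrs (s : Fin 2) (l : Fin 4) : List XV :=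
  if h : l.val = 0 then [port (topPort s)]
  else [tv s ⟨l.val - 1, by omega⟩ (botT ⟨l.val - 1, by omega⟩), tau s ⟨l.val - 1, by omega⟩]

/-- Both incarnations of the neighbour BELOW the copy `(s, l)`, or the bottom line end.
[cite: LiskiewiczOgiharaToda2003, §3, Fig. 2 (a)] -/
def botNbrs (s : Fin 2) (l : Fin 4) : List XV :=
  if h : l.val = 3 then [port (botPort s)]
  else [tv s ⟨l.val + 1, by omega⟩ (topT ⟨l.val + 1, by omega⟩), tau s ⟨l.val + 1, by omega⟩]

/-- Both incarnations of the RUNG partner of the copy `(s, l)`: the `c`-terminal of the copy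
facing it on the other line, and its contracted incarnation.
[cite: LiskiewiczOgiharaToda2003, §3, Fig. 2 (a)] -/
def rungNbrs (s : Fin 2) (l : Fin 4) : List XV :=
  [tv (1 - s) l 2, tau (1 - s) l]

/-- The outside neighbours (all incarnations) of vertex `i` of the copy `(s, l)`: nonempty only
for the three terminals. [cite: LiskiewiczOgiharaToda2003, §3, Fig. 2 (a)] -/
def extNbrs (s : Fin 2) (l : Fin 4) (i : Fin 15) : List XV :=
  (if i = topT l then topNbrs s l else []) ++ (if i = botT l then botNbrs s l else []) ++
    (if i = 2 then rungNbrs s l else [])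

/-- All neighbours of the contracted incarnation of the copy `(s, l)`.
[cite: LiskiewiczOgiharaToda2003, §3, Fig. 2 (a)] -/
def tauNbrs (s : Fin 2) (l : Fin 4) : List XV :=
  topNbrs s l ++ botNbrs s l ++ rungNbrs s l

/-- **Boolean adjacency of the staged XOR-gadget.** [cite: LiskiewiczOgiharaToda2003, §3, Fig. 2 (a)] -/
def xadj : XV → XV → Bool
  | tv s l i, w =>
    (match w with
      | tv s' l' j => decide (s = s' ∧ l = l') && TutteFragment.adj i j
      | _ => false) || decide (w ∈ extNbrs s l i)
  | tau s l, w => decide (w ∈ tauNbrs s l)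
  | port j, w =>
    (match w with
      | tv s l i => decide (port j ∈ extNbrs s l i)
      | tau s l => decide (port j ∈ tauNbrs s l)
      | jn => true
      | fr p q => decide (j = p ∨ j = q)
      | port _ => false)
  | fr p q, w => (match w with | port j => decide (j = p ∨ j = q) | _ => false)
  | jn, w => (match w with | port _ => true | _ => false)

/-- The adjacency is symmetric (by `decide`). [folklore] -/
theorem xadj_symm (v w : XV) : xadj v w = xadj w v := by
  revert v w; decide +kernel

/-- The adjacency is irreflexive (by `decide`). [folklore] -/
theorem xadj_irrefl (v : XV) : xadj v v = false := by
  revert v; decide +kernel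

end XV

open XV

/-- **The staged XOR-gadget** as a simple graph on `XV`. [cite: LiskiewiczOgiharaToda2003, §3, Fig. 2 (a)] -/
def xorGraph : _root_.SimpleGraph XV where
  Adj v w := xadj v w = true
  symm := ⟨fun v w h => by rw [xadj_symm]; exact h⟩
  loopless := ⟨fun v h => by rw [xadj_irrefl] at h; exact Bool.false_ne_true h⟩

/-- Decidability of adjacency. [folklore] -/
instance : DecidableRel xorGraph.Adj := fun v w => inferInstanceAs (Decidable (xadj v w = true))

namespace XV

/-! ### Copies, stages, vertex sets -/

/-- The index `4s + l ∈ {0, …, 7}` of the copy `(s, l)`: copies are contracted in decreasing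
index order. [folklore] -/
def cidx (s : Fin 2) (l : Fin 4) : ℕ := 4 * s.val + l.val

/-- **Stage `n` membership of the gadget part** (`n = 0, …, 8`): the copies of index `< n` are
expanded, the others contracted. [cite: GareyJohnson1979, §3.2.2 (local replacement, iterated)] -/
def inCore (n : ℕ) : XV → Bool
  | tv s l _ => decide (cidx s l < n)
  | tau s l => decide (n ≤ cidx s l)
  | _ => false

/-- The four line ends. [cite: LiskiewiczOgiharaToda2003, §3, Fig. 2 (a)] -/
def ports : Finset XV := Finset.univ.image port

/-- **The vertex set of stage `n` with the outside vertices `E`** (line ends, frame vertices,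
joiner, as the computation at hand requires). [cite: GareyJohnson1979, §3.2.2] -/
def stageVerts (n : ℕ) (E : Finset XV) : Finset XV := (Finset.univ.filter fun v => inCore n v) ∪ E

/-- The fifteen vertices of the copy `(s, l)`, listed. [cite: LiskiewiczOgiharaToda2003, §3, Fig. 2 (a)] -/
def copyList (s : Fin 2) (l : Fin 4) : List XV := (List.finRange 15).map fun i => tv s l i

/-- The fifteen vertices of the copy `(s, l)`. [cite: LiskiewiczOgiharaToda2003, §3, Fig. 2 (a)] -/
def copyVerts (s : Fin 2) (l : Fin 4) : Finset XV := (copyList s l).toFinset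

/-- The host part of stage `n + 1` (outside vertices `E`) relative to the copy `(s, l)` of index
`n`: everything of the stage but that copy. [cite: GareyJohnson1979, §3.2.2] -/
def hostVerts (n : ℕ) (s : Fin 2) (l : Fin 4) (E : Finset XV) : Finset XV :=
  (Finset.univ.filter fun v => inCore (n + 1) v && !decide (v ∈ copyVerts s l)) ∪ E

/-! ### Sanity checks -/

/-- Vertex counts: `149` names in all; with the four line ends as outside vertices the fully
expanded stage has `124` vertices (`120` copy vertices) and the fully contracted stage `12`
(by `decide`). [folklore] -/
theorem card_stageVerts :
    (Finset.univ : Finset XV).card = 149 ∧ (stageVerts 8 ports).card = 124 ∧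
      (stageVerts 0 ports).card = 12 := by
  decide +kernel

/-- **Degrees inside the gadget proper** (stage `8` with the four line ends): every copy vertex has
degree three — the gadget's terminals included, each terminal having exactly one outside edge
(line or rung) — and the four line ends have degree one (by `decide`).
[cite: LiskiewiczOgiharaToda2003, §3 ("the degree of the nodes in G is all three")] -/
theorem degree_stage8 :
    (∀ s l i, ((stageVerts 8 ports).filter fun w => xadj (tv s l i) w).card = 3) ∧
      ∀ j, ((stageVerts 8 ports).filter fun w => xadj (port j) w).card = 1 := by
  constructor <;> decide +kernel

/-- The fully contracted stage: each `tau` is joined to the `tau`s of its line neighbours and of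
its rung partner (and to a line end at the top and bottom), degree three; line ends have degree
one (their `tau`) (by `decide`). [folklore] -/
theorem degree_stage0 :
    (∀ s l, ((stageVerts 0 ports).filter fun w => xadj (tau s l) w).card = 3) ∧
      ∀ j, ((stageVerts 0 ports).filter fun w => xadj (port j) w).card = 1 := by
  constructor <;> decide +kernel

/-- Frame vertices and the joiner are adjacent to line ends only: `fr p q` to `p` and `q`, `jn`
to all four (by `decide`). [folklore] -/
theorem frame_adj :
    (∀ p q w, xadj (fr p q) w = true ↔ (w = port p ∨ w = port q)) ∧
      ∀ w, xadj jn w = true ↔ ∃ j, w = port j := by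
  constructor <;> decide +kernel

end XV

end Literature.Combinatorics.SimpleGraph
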